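import Literature.AlgebraicTopology.FundamentalGroup.PowerFactorCovering
import HarnessLib

/-!
# Homomorphisms commuting with the `n`-th power coverings: `h_*⁻¹((x ↦ xⁿ)_* π₁(G'')) = χ⁻¹(G[n] ∩ ker h)`

Companion of `PowerFactorCovering.lean`. Let `G`, `G''` be compact Hausdorff commutative topological
groups whose `n`-th power maps are surjective with finite kernels `G[n]`, `G''[n]` (so that they are
normal coverings, `TopologicalGroupCovering.lean`; `G` path connected), and let `h : G → G''` be a
continuous homomorphism — it commutes with the power maps, `h(xⁿ) = h(x)ⁿ`. Then for a loop class
`γ` at `1 ∈ G` with `xⁿ`-monodromy `g_γ ∈ G[n]` (the end point of the lift of `γ` from `1`):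

* `monodromy_pow_map_eq`: the `xⁿ`-monodromy of `h ∘ γ` in `G''` is `h(g_γ)` (the lift of `h ∘ γ`
  is `h` of the lift of `γ`; uniqueness of lifts, Hatcher, *Algebraic Topology*, Prop. 1.34);
* `comap_mapOfEq_range_powMap_eq`: **`h_* γ ∈ (x ↦ xⁿ)_* π₁(G'', 1)` iff `g_γ ∈ ker h`**, i.e.
  `h_*⁻¹((x ↦ xⁿ)_* π₁(G'')) = χ⁻¹(G[n] ∩ ker h)` with `χ : π₁(G, 1) → G[n]ᵒᵖ` the monodromy of
  `x ↦ xⁿ` on `G` (Hatcher Prop. 1.31–1.33, 1.39);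
* `map_mapOfEq_le_range_powMap`: consequently, if a subgroup `M ⊆ π₁(G, 1)` has `χ(M) ⊆ ker h`,
  then `h_*(M) ⊆ (x ↦ xⁿ)_* π₁(G'', 1)` — so that (lifting criterion, Hatcher Prop. 1.33) maps into
  `G` with `π₁`-image `M`, composed with `h`, lift through the covering `x ↦ xⁿ` of `G''`.

For a complex abelian variety `J`, `M = (f^P)_* π₁(C(ℂ))` and the quotient isogeny
`h : J → J/S`, `S = χ(M) ⊆ J[2](ℂ)`, this makes `h ∘ f^P` lift through the étale isogeny `[2]` of
`J/S` (towards `Literature.AlgebraicGeometry.Motives.isIso_bettiCohomology_map_abelJacobi`).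
Everything is proved; no definitions.

## References

* A. Hatcher, *Algebraic Topology*, CUP 2002, §1.3 Prop. 1.31–1.34, Prop. 1.39. [HatcherAT2002]
-/

noncomputable section

open Function Topology

universe u v

namespace Literature.AlgebraicTopology.FundamentalGroup

/-- Transport of path classes along a commuting triangle of continuous maps `b ∘ a = c`: the image
under `b` of (a cast of) `a ∘ L` is (a cast of) `c ∘ L`. [folklore] -/
theorem map_cast_map_eq_of_comp_eq {X : Type u} {Y : Type v} {Z : Type*} [TopologicalSpace X]
    [TopologicalSpace Y] [TopologicalSpace Z] (a : C(X, Y)) (b : C(Y, Z)) (c : C(X, Z))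
    (habc : ∀ x, b (a x) = c x) {x₀ x₁ : X} (L : Path.Homotopic.Quotient x₀ x₁) {y₀ y₁ : Y}
    (h₀ : y₀ = a x₀) (h₁ : y₁ = a x₁) :
    ((L.map a).cast h₀ h₁).map b =
      (L.map c).cast (show b y₀ = c x₀ by rw [h₀, habc]) (show b y₁ = c x₁ by rw [h₁, habc]) := by
  subst h₀ h₁
  induction L using Quotient.inductionOn with | h ℓ =>
  change Path.Homotopic.Quotient.mk (((ℓ.map a.continuous).cast rfl rfl).map b.continuous) =
    Path.Homotopic.Quotient.mk ((ℓ.map c.continuous).cast _ _)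
  congr 1
  ext x
  exact habc (ℓ x)

variable {G : Type u} {G'' : Type v} [TopologicalSpace G] [CommGroup G] [IsTopologicalGroup G]
  [CompactSpace G] [T2Space G]
  [TopologicalSpace G''] [CommGroup G''] [IsTopologicalGroup G''] [CompactSpace G''] [T2Space G'']
  (h : G →* G'') (n : ℕ)

/-- **The `xⁿ`-monodromy of `h ∘ γ` is `h(g_γ)`**: if the lift of `γ` along `x ↦ xⁿ` on `G` from `1`
ends at `g_γ ∈ G[n]`, then the lift of `h ∘ γ` along `x ↦ xⁿ` on `G''` from `1` ends at `h(g_γ)` —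
it is `h` of the lift of `γ` (`h(xⁿ) = h(x)ⁿ` and uniqueness of lifts, Hatcher Prop. 1.34).
[cite: HatcherAT2002, §1.3 Prop. 1.34] -/
theorem monodromy_pow_map_eq (hh : Continuous h) (hpow : Surjective fun x : G => x ^ n)
    (hfin : ((powMonoidHom n : G →* G).ker : Set G).Finite) (hpow'' : Surjective fun x : G'' => x ^ n)
    (hfin'' : ((powMonoidHom n : G'' →* G'').ker : Set G'').Finite) (γ : FundamentalGroup G (1 : G)) :
    ((isQuotientCoveringMap_pow n hpow'' hfin'' (G := G'')).isCoveringMap.monodromy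
        (FundamentalGroup.mapOfEq (⟨h, hh⟩ : C(G, G'')) (map_one h) γ) ⟨1, one_mem_preimage_pow n⟩ : G'') =
      h ((isQuotientCoveringMap_pow n hpow hfin (G := G)).isCoveringMap.monodromy γ
        ⟨1, one_mem_preimage_pow n⟩ : G) := by
  have covn : IsCoveringMap (powMonoidHom n : G →* G) :=
    (isQuotientCoveringMap_pow n hpow hfin (G := G)).isCoveringMap
  have covn'' : IsCoveringMap (powMonoidHom n : G'' →* G'') :=
    (isQuotientCoveringMap_pow n hpow'' hfin'' (G := G'')).isCoveringMap
  let e : (powMonoidHom n : G →* G) ⁻¹' {1} := ⟨1, one_mem_preimage_pow n⟩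
  let g : (powMonoidHom n : G →* G) ⁻¹' {1} := covn.monodromy γ e
  have hg1 : (g : G) ^ n = 1 := by
    have := g.2
    rwa [Set.mem_preimage, powMonoidHom_apply, Set.mem_singleton_iff] at this
  have hhg : h (g : G) ∈ (powMonoidHom n : G'' →* G'') ⁻¹' {1} := by
    rw [Set.mem_preimage, Set.mem_singleton_iff, powMonoidHom_apply, ← map_pow, hg1, map_one]
  -- the lift of `h ∘ γ` is `h ∘ (lift of γ)`
  let Γ : Path.Homotopic.Quotient (1 : G'') (h (g : G)) :=
    ((covn.liftPathQuotient γ e).map ⟨h, hh⟩).cast (map_one h).symm rfl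
  have key := covn''.monodromy_eq_of_map_eq
    (γ := FundamentalGroup.mapOfEq (⟨h, hh⟩ : C(G, G'')) (map_one h) γ)
    (ex := ⟨1, one_mem_preimage_pow n⟩) (ey := ⟨h (g : G), hhg⟩) Γ (by
      change (((covn.liftPathQuotient γ e).map ⟨h, hh⟩).cast (map_one h).symm rfl).map
        ⟨(powMonoidHom n : G'' →* G''), covn''.continuous⟩ = _
      have hc : ∀ x, (⟨(powMonoidHom n : G'' →* G''), covn''.continuous⟩ : C(G'', G''))
          ((⟨h, hh⟩ : C(G, G'')) x) =
          ((⟨h, hh⟩ : C(G, G'')).comp ⟨(powMonoidHom n : G →* G), covn.continuous⟩) x := fun x => by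
        simp [map_pow]
      rw [map_cast_map_eq_of_comp_eq _ _ _ hc, Path.Homotopic.Quotient.map_comp,
        covn.map_liftPathQuotient, Path.Homotopic.Quotient.map_cast, FundamentalGroup.mapOfEq_apply,
        Path.Homotopic.Quotient.cast_cast]
      exact Path.Homotopic.Quotient.cast_cast (X := G'') _ _ _ _ _)
  exact congrArg Subtype.val key

/-- **`h_* γ ∈ (x ↦ xⁿ)_* π₁(G'', 1)` iff `g_γ ∈ ker h`**: the preimage under `h_*` of the image of
`π₁` of the covering `x ↦ xⁿ` of `G''` is `χ⁻¹(G[n] ∩ ker h)`, where `χ : π₁(G, 1) → G[n]ᵒᵖ` is the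
monodromy of the covering `x ↦ xⁿ` of `G` (a loop lifts iff its monodromy is trivial, Hatcher
Prop. 1.31–1.33, and `monodromy_pow_map_eq`). [cite: HatcherAT2002, §1.3 Prop. 1.39] -/
theorem comap_mapOfEq_range_powMap_eq [PathConnectedSpace G] (hh : Continuous h)
    (hpow : Surjective fun x : G => x ^ n) (hfin : ((powMonoidHom n : G →* G).ker : Set G).Finite)
    (hpow'' : Surjective fun x : G'' => x ^ n)
    (hfin'' : ((powMonoidHom n : G'' →* G'').ker : Set G'').Finite) :
    (FundamentalGroup.mapOfEq (powMap G'' n) (powMap_one n)).range.comap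
        (FundamentalGroup.mapOfEq (⟨h, hh⟩ : C(G, G'')) (map_one h)) =
      (Subgroup.op (h.ker.subgroupOf (powMonoidHom n : G →* G).ker)).comap
        ((isQuotientCoveringMap_pow n hpow hfin (G := G)).fundamentalGroupToMulOpposite
          ⟨1, one_mem_preimage_pow n⟩) := by
  have hpn : IsQuotientCoveringMap (powMonoidHom n : G →* G) (powMonoidHom n : G →* G).ker :=
    isQuotientCoveringMap_pow n hpow hfin
  have hpn'' : IsQuotientCoveringMap (powMonoidHom n : G'' →* G'') (powMonoidHom n : G'' →* G'').ker :=
    isQuotientCoveringMap_pow n hpow'' hfin''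
  let e : (powMonoidHom n : G →* G) ⁻¹' {1} := ⟨1, one_mem_preimage_pow n⟩
  let e'' : (powMonoidHom n : G'' →* G'') ⁻¹' {1} := ⟨1, one_mem_preimage_pow n⟩
  ext γ
  set δ := FundamentalGroup.mapOfEq (⟨h, hh⟩ : C(G, G'')) (map_one h) γ with hδ
  -- `δ ∈ (xⁿ)_* π₁(G'') ↔ monodromy δ e'' = e''`
  have h1 : δ ∈ (FundamentalGroup.mapOfEq (powMap G'' n) (powMap_one n)).range ↔
      hpn''.isCoveringMap.monodromy δ e'' = e'' := by
    have hr : (FundamentalGroup.mapOfEq (powMap G'' n) (powMap_one n)).range =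
        (FundamentalGroup.mapOfEq (⟨(powMonoidHom n : G'' →* G''), hpn''.continuous⟩ : C(G'', G''))
          e''.2).range := rfl
    rw [hr, ← hpn''.ker_monodromyPerm e'', MonoidHom.mem_ker, ← hpn''.monodromy_eq_id_iff e'']
    constructor
    · intro hγ
      funext x
      have := congrArg (fun f : Equiv.Perm ((powMonoidHom n : G'' →* G'') ⁻¹' {1}) => f x) hγ
      simpa using this
    · intro hγ
      exact Equiv.ext (congrFun hγ)
  rw [Subgroup.mem_comap, h1, Subgroup.mem_comap, Subgroup.mem_op, Subgroup.mem_subgroupOf,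
    MonoidHom.mem_ker, Subtype.ext_iff, hδ, monodromy_pow_map_eq h n hh hpow hfin hpow'' hfin'' γ]
  have h2 := hpn.unop_fundamentalGroupToMulOpposite_smul (e := e) (γ := γ)
  rw [Submonoid.smul_def, smul_eq_mul, mul_one] at h2
  change h _ = 1 ↔ h _ = 1
  rw [← h2]

/-- **Lifting through `x ↦ xⁿ` after `h`**: if `M ⊆ π₁(G, 1)` has monodromy `χ(M) ⊆ ker h`
(`χ : π₁(G, 1) → G[n]ᵒᵖ` the monodromy of `x ↦ xⁿ` on `G`), then `h_*(M) ⊆ (x ↦ xⁿ)_* π₁(G'', 1)`;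
so a map `f` into `G` from a path-connected, locally path-connected space with `f_* π₁ ⊆ M` has
`h ∘ f` lifting through the covering `x ↦ xⁿ` of `G''` (Hatcher Prop. 1.33).
[cite: HatcherAT2002, §1.3 Prop. 1.33 and Prop. 1.39] -/
theorem map_mapOfEq_le_range_powMap [PathConnectedSpace G] (hh : Continuous h)
    (hpow : Surjective fun x : G => x ^ n) (hfin : ((powMonoidHom n : G →* G).ker : Set G).Finite)
    (hpow'' : Surjective fun x : G'' => x ^ n)
    (hfin'' : ((powMonoidHom n : G'' →* G'').ker : Set G'').Finite)
    (M : Subgroup (FundamentalGroup G (1 : G)))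
    (hM : ∀ m ∈ M, (((isQuotientCoveringMap_pow n hpow hfin (G := G)).fundamentalGroupToMulOpposite
      ⟨1, one_mem_preimage_pow n⟩ m).unop : G) ∈ h.ker) :
    M.map (FundamentalGroup.mapOfEq (⟨h, hh⟩ : C(G, G'')) (map_one h)) ≤
      (FundamentalGroup.mapOfEq (powMap G'' n) (powMap_one n)).range := by
  rw [Subgroup.map_le_iff_le_comap, comap_mapOfEq_range_powMap_eq h n hh hpow hfin hpow'' hfin'']
  intro m hm
  rw [Subgroup.mem_comap, Subgroup.mem_op, Subgroup.mem_subgroupOf]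
  exact hM m hm

end Literature.AlgebraicTopology.FundamentalGroup

end
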